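import Summits.QuantumFields.YangMills.Theorems.BalabanLadderNTWeakPackageTwoPoint
import Summits.QuantumFields.YangMills.Theorems.BalabanLadderUVSeamRecUnitDilation
import HarnessLib

/-!
# Crux `UVSeamRec` (stmt-QuantumFields-20043), floors side: scale-window two-point floors from the WEAK floor clause (F)

Helper file of the fleet lead prover of crux `NT` (unit `ym-spine-19353-p1`, g2), for the seam's femto discharge path
(owner ym-beyond-p2 g20, 2026-08-26 16:24Z: «a weak-package variant of `stubFloorsEngine_of_windowEngineC` is a welcome
helper»).  VERBATIM re-run of the landed `WindowFloors.twoPoint_floor_param_ratio` / `windowFloors_twoPoint_ratio`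
(`Theorems/BalabanLadderUVSeamRecWindowFloorsTwoPointRatio.lean`, ym-spine-20043-p1) with the registered two-point clause
`FC2 G r a` replaced by the WEAK FLOOR CLAUSE (F) of crux `NT`'s skeleton v3 «weak-package» (`stub_cfpw : CFPW`,
374f16092bb0c203): x-centred femto cubes, lower bound only, forward cone, growth `Γ(s)/s⁸ → ∞` — through the landed
`WeakPackage.pair_floor_weak` (`Theorems/BalabanLadderNTWeakPackageTwoPoint.lean`).

* `twoPoint_floor_param_ratio_weak` — parametric two-point floor, window `[κs, s]`, from `FBL ∧ (F)`;
* `windowFloors_twoPoint_ratio_weak` — ONE compactly supported positive-time bump floors `Q2(θv, v)` at every smearing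
  scale `a β / t`, `t ∈ [κ, 1]`.
-/

set_option autoImplicit false

noncomputable section

open scoped SchwartzMap
open MeasureTheory Filter Topology Metric
open Literature.MathematicalPhysics.QuantumFieldTheory Literature.MathematicalPhysics.QuantumLattice
open Literature.MathematicalPhysics.AQFT Literature.Probability.LatticeModels
open Summit.QuantumFields.YangMills.Theorems.OSLegsFromFemtoAndGap.StubLower
open Summit.QuantumFields.YangMills.Cruxes.OSLegsFromFemtoAndGap.DlrCollarTransfer
open Summit.QuantumFields.YangMills.Cruxes.OSLegsFromFemtoAndGap.DlrCollarTransfer.StubLower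

namespace Summit.QuantumFields.YangMills.Cruxes.UVSeamRec.WeakWindow

section TwoPoint

variable (G : Type) [Group G] [TopologicalSpace G] [IsTopologicalGroup G] [CompactSpace G]
  [MeasurableSpace G] [BorelSpace G] (r : LatticeRep G) (a : ℝ → ℝ)

/-- **Parametric two-point floor, ratio `κ`, weak floor clause.**  From `FBL ∧ (F)` at a unit map `a > 0`, `a → 0`: there are a master scale
`s > 0` and `ε, β₅, Λ₅` such that for EVERY scale `s' ∈ [κs, s]` and EVERY test function `w ≥ 0` equal to `1` on
`closedBall ((s'/2)e₀) (s'/8)` and vanishing off `ball ((s'/2)e₀) (s'/4)`, the reflection-paired smeared two-point function is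
floored: `ε ≤ Q2 G r β L (a β) (θw, w)` for `β ≥ β₅`, `Λ₅ ≤ a β · L` (= `StubLower.lowerBounds_twoPoint` with the bump as a
parameter; every estimate is the landed toolkit's). [folklore] -/
theorem twoPoint_floor_param_ratio_weak {κ : ℝ} (hκ : 0 < κ) (hapos : ∀ β, 0 < a β)
    (hlim : Tendsto a atTop (𝓝 0)) (hFBL : FBL G r a)
    (hF : ∃ (Γ : ℝ → ℝ) (β₂ ℓ₂ c₂ : ℝ) (K : ℝ → ℝ) (n₀ : ℕ), 0 < ℓ₂ ∧ 0 < c₂ ∧ (∀ s, 1 ≤ K s) ∧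
      Tendsto (fun s : ℝ => s * K s) (nhdsWithin 0 (Set.Ioi 0)) (nhds 0) ∧ 1 ≤ n₀ ∧
      Tendsto (fun s : ℝ => Γ s / s ^ 8) (nhdsWithin 0 (Set.Ioi 0)) atTop ∧
      ∀ β : ℝ, β₂ ≤ β → ∀ (x : Fin 4 → ℤ) (R : ℕ), ((2 * R + 1 : ℕ) : ℝ) * a β ≤ ℓ₂ →
        ∀ (η : LGConfig 4 G) (y : Fin 4 → ℤ) (s₀ : ℝ), 0 < s₀ → s₀ ≤ ‖siteToE (y - x)‖ * a β →
          (n₀ : ℝ) ≤ ‖siteToE (y - x)‖ → ‖siteToE (y - x)‖ < 3 * siteToE (y - x) 0 →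
            K s₀ * ‖siteToE (y - x)‖ ≤ depth (fun j => x j - R) (2 * R + 1) y →
              c₂ * Γ (‖siteToE (y - x)‖ * a β) ≤
                ‖siteToE (y - x)‖ ^ 8 *
                  kerCov G r β (fun j => x j - R) (2 * R + 1) η (dens G r x) (dens G r y)) :
    ∃ (s ε β₅ Λ₅ : ℝ), 0 < s ∧ 0 < ε ∧ ∀ s' ∈ Set.Icc (κ * s) s,
      ∀ w : 𝓢(EuclideanSpace ℝ (Fin 4), ℝ), (∀ z, 0 ≤ w z) →
        (∀ z, dist z (EuclideanSpace.single 0 (s' / 2)) ≤ s' / 8 → w z = 1) →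
        (∀ z, w z ≠ 0 → dist z (EuclideanSpace.single 0 (s' / 2)) < 2 * (s' / 8)) →
        ∀ β : ℝ, β₅ ≤ β → ∀ L : ℕ, Λ₅ ≤ a β * L → ε ≤ Q2 G r β L (a β) (thetaTest 4 w) w := by
  obtain ⟨C₁, β₁, ℓ₁, p, hℓ₁, hC₁, hFBLc⟩ := hFBL
  obtain ⟨Γ, β₂, ℓ₂, c₂, K, n₀, hℓ₂, hc₂, hK1, hKlim, hn₀, hΓlim, hFc⟩ := hF
  -- the constants (as in `lowerBounds_twoPoint`)
  obtain ⟨ℓ, hℓ⟩ : ∃ ℓ : ℝ, ℓ = min ℓ₁ ℓ₂ := ⟨_, rfl⟩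
  have hℓ0 : 0 < ℓ := by rw [hℓ]; exact lt_min hℓ₁ hℓ₂
  have hℓℓ₁ : ℓ ≤ ℓ₁ := hℓ ▸ min_le_left _ _
  have hℓℓ₂ : ℓ ≤ ℓ₂ := hℓ ▸ min_le_right _ _
  obtain ⟨D, hD⟩ : ∃ D : ℝ, D = ℓ / 100 := ⟨_, rfl⟩
  have hD0 : 0 < D := by rw [hD]; positivity
  obtain ⟨M, hM⟩ : ∃ M : ℝ, M = 8 * C₁ ^ 2 / (c₂ * D ^ 8) + 1 := ⟨_, rfl⟩
  have hM0 : 0 < M := by rw [hM]; positivity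
  have hMC : 4 * C₁ ^ 2 / D ^ 8 ≤ c₂ * M / 2 := by
    have : c₂ * M / 2 = 4 * C₁ ^ 2 / D ^ 8 + c₂ / 2 := by
      rw [hM]; field_simp; ring
    rw [this]; linarith
  obtain ⟨δ₁, hδ₁, hKδ⟩ := exists_delta_of_tendsto_mul hKlim (ε := ℓ / 100) (by positivity)
  obtain ⟨δ₂, hδ₂, hΓδ⟩ := exists_delta_of_tendsto_div_atTop hΓlim M
  obtain ⟨s, hs⟩ : ∃ s : ℝ, s = min (min δ₁ (δ₂ / 2)) (ℓ / 100) := ⟨_, rfl⟩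
  have hs0 : 0 < s := by rw [hs]; positivity
  have hsδ₁ : s ≤ δ₁ := by rw [hs]; exact (min_le_left _ _).trans (min_le_left _ _)
  have hsδ₂' : s ≤ δ₂ / 2 := by rw [hs]; exact (min_le_left _ _).trans (min_le_right _ _)
  have hsℓ : s ≤ ℓ / 100 := by rw [hs]; exact min_le_right _ _
  -- small spacings, uniformly for `s' ≥ κ s`
  have hn₀0 : (0 : ℝ) < n₀ := by exact_mod_cast hn₀
  obtain ⟨β₀, hβ₀⟩ := exists_of_tendsto_atTop_nhds_zero hlim
    (a₀ := min (ℓ / 100) (min (κ * s / (2 * n₀)) (κ * s / 16))) (by positivity)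
  refine ⟨s, c₂ * M / 2 * (κ * s / 16) ^ 8, max β₀ (max β₁ β₂), ℓ, hs0, by positivity, ?_⟩
  intro s' hs' w hw0 hwone hwsupp β hβ L hL
  obtain ⟨hs'lo, hs'hi⟩ := hs'
  have hκs : 0 < κ * s := mul_pos hκ hs0
  have hs'0 : 0 < s' := by linarith
  have hs'δ₁ : s' ≤ δ₁ := hs'hi.trans hsδ₁
  have hs'δ₂ : 3 * s' / 2 < δ₂ := by linarith
  have hs'ℓ : s' ≤ ℓ / 100 := hs'hi.trans hsℓ
  have hs'K : s' * K (s' / 2) < 2 * ℓ / 100 := by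
    have := hKδ (s' / 2) (by positivity) (by linarith)
    linarith
  have hββ₀ : β₀ ≤ β := le_of_max_le_left hβ
  have hββ₁ : β₁ ≤ β := le_of_max_le_left (le_of_max_le_right hβ)
  have hββ₂ : β₂ ≤ β := le_of_max_le_right (le_of_max_le_right hβ)
  have hα := hapos β
  have hαa₀ := hβ₀ β hββ₀
  have hαℓ : a β ≤ ℓ / 100 := (hαa₀.trans_le (min_le_left _ _)).le
  have hαn : a β ≤ κ * s / (2 * n₀) := (hαa₀.trans_le ((min_le_right _ _).trans (min_le_left _ _))).le
  have hακ16 : a β ≤ κ * s / 16 := (hαa₀.trans_le ((min_le_right _ _).trans (min_le_right _ _))).le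
  have hα16 : a β ≤ s' / 16 := by linarith
  have hαn₀ : (n₀ : ℝ) * a β ≤ s' / 2 := by
    rw [le_div_iff₀ (by positivity)] at hαn; linarith
  obtain ⟨hfem₁, hfem₂, hL'⟩ :=
    femto_budget (L := L) hℓℓ₁ hℓℓ₂ hs'ℓ hs'0 hs'K hαℓ hL
  rw [← hD] at hfem₁ hfem₂ hL'
  -- the per-pair floor at scale `s'`
  have key : ∀ x y : Fin 4 → ℤ, thetaTest 4 w (a β • siteToE x) ≠ 0 → w (a β • siteToE y) ≠ 0 →
      c₂ * M / 2 * a β ^ 8 ≤ torusE G r β L (fun U => dens G r x U * dens G r y U)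
        - torusE G r β L (dens G r x) * torusE G r β L (dens G r y) := by
    intro x y hx hy
    refine NT.WeakPackage.pair_floor_weak G r a hC₁ hFBLc hc₂ hK1 hFc hs'0 hD0 hΓδ hs'δ₂ hMC hββ₁ hββ₂ hα hαn₀
      hfem₁ hfem₂ hL' x y ?_ ?_
    · rw [thetaTest_apply] at hx
      have := hwsupp _ hx
      rw [dist_eq_norm, norm_timeReflection_sub_single] at this
      linarith
    · have := hwsupp _ hy
      rw [dist_eq_norm] at this
      linarith
  -- Riemann mass of the two plateaux
  have hcover : ∀ j, |(EuclideanSpace.single (0 : Fin 4) (s' / 2) : EuclideanSpace ℝ (Fin 4)) j|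
      + s' / 8 ≤ a β * L := fun j => by
    have : |(EuclideanSpace.single (0 : Fin 4) (s' / 2) : EuclideanSpace ℝ (Fin 4)) j| ≤ s' / 2 := by
      rw [PiLp.single_apply]
      split_ifs
      · rw [abs_of_pos (by positivity)]
      · rw [abs_zero]; positivity
    nlinarith
  have hSy : (s' / 8 / (2 * a β)) ^ 4 ≤ ∑ y ∈ box 4 L, w (a β • siteToE y) :=
    pow_le_sum_box hw0 hα (fun z hz => hwone z hz) (by linarith) hcover
  have hSx : (s' / 8 / (2 * a β)) ^ 4 ≤ ∑ x ∈ box 4 L, thetaTest 4 w (a β • siteToE x) := by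
    refine pow_le_sum_box (p := -EuclideanSpace.single 0 (s' / 2)) (fun z => ?_) hα
      (fun z hz => ?_) (by linarith) (fun j => by simpa using hcover j)
    · rw [thetaTest_apply]; exact hw0 _
    · rw [thetaTest_apply]
      refine hwone _ ?_
      rwa [dist_eq_norm, norm_timeReflection_sub_single, ← sub_neg_eq_add, ← dist_eq_norm]
  -- summation
  have hsum := mul_sum_mul_sum_le (B := box 4 L) (κ := c₂ * M / 2 * a β ^ 8)
    (f := fun x => thetaTest 4 w (a β • siteToE x)) (g := fun y => w (a β • siteToE y))
    (C := fun x y => torusE G r β L (fun U => dens G r x U * dens G r y U)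
      - torusE G r β L (dens G r x) * torusE G r β L (dens G r y))
    (fun x => by rw [thetaTest_apply]; exact hw0 _) (fun y => hw0 _) key
  unfold Q2
  refine le_trans ?_ hsum
  have hα0 : a β ≠ 0 := hα.ne'
  have hmono : c₂ * M / 2 * (κ * s / 16) ^ 8 ≤ c₂ * M / 2 * (s' / 16) ^ 8 := by
    have h1 : κ * s / 16 ≤ s' / 16 := by linarith
    have h2 : 0 ≤ κ * s / 16 := by positivity
    exact mul_le_mul_of_nonneg_left (pow_le_pow_left₀ h2 h1 8) (by positivity)
  refine hmono.trans ?_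
  calc c₂ * M / 2 * (s' / 16) ^ 8
      = c₂ * M / 2 * a β ^ 8 * ((s' / 8 / (2 * a β)) ^ 4 * (s' / 8 / (2 * a β)) ^ 4) := by
        field_simp; ring
    _ ≤ _ := mul_le_mul_of_nonneg_left (mul_le_mul hSx hSy (by positivity)
        ((by positivity : (0 : ℝ) ≤ (s' / 8 / (2 * a β)) ^ 4).trans hSx)) (by positivity)

/-- **Scale-window two-point floors, ratio `κ`, weak floor clause** (the two-point hypothesis of
`WindowTransfer.lowerBounds_of_window` with window `[κ, 1]`): from `FBL ∧ (F)` at `a > 0`, `a → 0`, ONE compactly supported positive-time bump `v` floors the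
reflection-paired two-point function at EVERY smearing scale `a β / t`, `t ∈ [κ, 1]`, uniformly. [folklore] -/
theorem windowFloors_twoPoint_ratio_weak {κ : ℝ} (hκ : 0 < κ) (hapos : ∀ β, 0 < a β)
    (hlim : Tendsto a atTop (𝓝 0)) (hFBL : FBL G r a)
    (hF : ∃ (Γ : ℝ → ℝ) (β₂ ℓ₂ c₂ : ℝ) (K : ℝ → ℝ) (n₀ : ℕ), 0 < ℓ₂ ∧ 0 < c₂ ∧ (∀ s, 1 ≤ K s) ∧
      Tendsto (fun s : ℝ => s * K s) (nhdsWithin 0 (Set.Ioi 0)) (nhds 0) ∧ 1 ≤ n₀ ∧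
      Tendsto (fun s : ℝ => Γ s / s ^ 8) (nhdsWithin 0 (Set.Ioi 0)) atTop ∧
      ∀ β : ℝ, β₂ ≤ β → ∀ (x : Fin 4 → ℤ) (R : ℕ), ((2 * R + 1 : ℕ) : ℝ) * a β ≤ ℓ₂ →
        ∀ (η : LGConfig 4 G) (y : Fin 4 → ℤ) (s₀ : ℝ), 0 < s₀ → s₀ ≤ ‖siteToE (y - x)‖ * a β →
          (n₀ : ℝ) ≤ ‖siteToE (y - x)‖ → ‖siteToE (y - x)‖ < 3 * siteToE (y - x) 0 →
            K s₀ * ‖siteToE (y - x)‖ ≤ depth (fun j => x j - R) (2 * R + 1) y →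
              c₂ * Γ (‖siteToE (y - x)‖ * a β) ≤
                ‖siteToE (y - x)‖ ^ 8 *
                  kerCov G r β (fun j => x j - R) (2 * R + 1) η (dens G r x) (dens G r y)) :
    ∃ (v : 𝓢(EuclideanSpace ℝ (Fin 4), ℝ)) (ε β₅ Λ₅ : ℝ),
      HasCompactSupport (v : EuclideanSpace ℝ (Fin 4) → ℝ) ∧
      tsupport (v : EuclideanSpace ℝ (Fin 4) → ℝ) ⊆ {y : EuclideanSpace ℝ (Fin 4) | 0 < y 0} ∧ 0 < ε ∧
      ∀ t ∈ Set.Icc κ 1, ∀ β : ℝ, β₅ ≤ β → ∀ L : ℕ, Λ₅ ≤ a β * L →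
        ε ≤ Q2 G r β L (a β / t) (thetaTest 4 v) v := by
  obtain ⟨s, ε, β₅, Λ₅, hs0, hε, H⟩ := twoPoint_floor_param_ratio_weak G r a hκ hapos hlim hFBL hF
  -- the bump at the master scale `s`
  obtain ⟨v, hv0, -, hvone, hvsupp, hvts⟩ :=
    exists_bump_schwartz (EuclideanSpace.single 0 (s / 2)) (ρ := s / 8) (by positivity)
  refine ⟨v, ε, β₅, Λ₅, ?_, ?_, hε, fun t ht β hβ L hL => ?_⟩
  · rw [HasCompactSupport, hvts]; exact isCompact_closedBall _ _
  · rw [hvts]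
    intro y hy
    rw [mem_closedBall, dist_eq_norm] at hy
    have h1 := abs_apply_le_norm (y - EuclideanSpace.single 0 (s / 2)) 0
    have h2 : |y 0 - s / 2| ≤ 2 * (s / 8) := by simpa using h1.trans hy
    show 0 < y 0
    have := (abs_le.1 h2).1
    linarith
  -- dilate: unit `a/t` for `v` = unit `a` for `v ∘ (t⁻¹ • ·)`, a bump at scale `t·s ∈ [κs, s]`
  obtain ⟨htlo, hthi⟩ := ht
  have ht0 : 0 < t := by linarith
  obtain ⟨Dl, hDl⟩ := UnitDilation.exists_dilation t⁻¹ (inv_ne_zero ht0.ne')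
  have hscale : a β / t = t⁻¹ * (a β / t * t) := by field_simp
  have hQ : Q2 G r β L (a β / t) (thetaTest 4 v) v =
      Q2 G r β L (a β) (thetaTest 4 (SchwartzMap.compCLMOfContinuousLinearEquiv ℝ Dl v))
        (SchwartzMap.compCLMOfContinuousLinearEquiv ℝ Dl v) := by
    rw [UnitDilation.Q2_theta_compCLM Dl t⁻¹ hDl]
    congr 1
    field_simp
  rw [hQ]
  -- the dilated bump's data at scale `s' = t * s`
  have hcen : ∀ z : EuclideanSpace ℝ (Fin 4),
      dist (t⁻¹ • z) (EuclideanSpace.single 0 (s / 2)) = t⁻¹ * dist z (EuclideanSpace.single 0 (t * s / 2)) := by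
    intro z
    have h1 : (EuclideanSpace.single 0 (s / 2) : EuclideanSpace ℝ (Fin 4)) =
        t⁻¹ • EuclideanSpace.single 0 (t * s / 2) := by
      ext i
      simp only [PiLp.single_apply, PiLp.smul_apply, smul_eq_mul]
      split_ifs
      · field_simp
      · rw [mul_zero]
    rw [h1, dist_eq_norm, dist_eq_norm, ← smul_sub, norm_smul, Real.norm_eq_abs, abs_of_pos (inv_pos.2 ht0)]
  have hts : t * s ∈ Set.Icc (κ * s) s :=
    ⟨mul_le_mul_of_nonneg_right htlo hs0.le, by nlinarith⟩
  refine H (t * s) hts _ (fun z => ?_) (fun z hz => ?_) (fun z hz => ?_) β hβ L hL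
  · rw [SchwartzMap.compCLMOfContinuousLinearEquiv_apply, Function.comp_apply, hDl]; exact hv0 _
  · rw [SchwartzMap.compCLMOfContinuousLinearEquiv_apply, Function.comp_apply, hDl]
    refine hvone _ ?_
    rw [hcen]
    calc t⁻¹ * dist z (EuclideanSpace.single 0 (t * s / 2)) ≤ t⁻¹ * (t * s / 8) :=
          mul_le_mul_of_nonneg_left hz (inv_pos.2 ht0).le
      _ = s / 8 := by field_simp
  · rw [SchwartzMap.compCLMOfContinuousLinearEquiv_apply, Function.comp_apply, hDl] at hz
    have h1 := hvsupp _ hz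
    rw [hcen] at h1
    have h2 : t⁻¹ * dist z (EuclideanSpace.single 0 (t * s / 2)) < t⁻¹ * (2 * (t * s / 8)) := by
      calc t⁻¹ * dist z (EuclideanSpace.single 0 (t * s / 2)) < 2 * (s / 8) := h1
        _ = t⁻¹ * (2 * (t * s / 8)) := by field_simp
    exact lt_of_mul_lt_mul_left h2 (inv_pos.2 ht0).le

end TwoPoint

end Summit.QuantumFields.YangMills.Cruxes.UVSeamRec.WeakWindow

end
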